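import Summits.HodgeConjecture.HodgeConjecture.Theorems.Ring2WeilCoverageCMFieldZeta5
import HarnessLib

/-!
# Ring 2 — Weil-type family-coverage census, CM-field rows (X-X): the first NON-SPLIT row of a SEXTIC table in the
# kernel — `[3w] ≠ [1]` (`3 ∤ w`) in `ℚ(ζ₇)⁺^× / Nm ℚ(ζ₇)^×` on Deligne's carrier `R = S³ + 7S² + 14S + 7`

HONEST FRAMING: research route conditional on HC_CM; not a corollary; Q11.4-sentence-2 already refuted in dim ≥ 3.

Cell `pub-hodge-ring2`, seat `ring2-b03` (gen 58), census `WEIL-FAMILY-COVERAGE.md` «## b03» b03.23 (the `g = 12` rows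
`(3,2)`): the δ-class table of `E = ℚ(ζ₇)` over `F = ℚ(ζ₇)⁺` (certified computation, kit j209882 ×2) has `[2]
    = [7] = [1]`
and its first non-split integer row at `n = 3`, `T(3) = {𝔭₇, (3)}`. This file DECIDES that row in the kernel, on the
carriers `F = realField R = ℚ[S]/(S³ + 7S² + 14S + 7)` (`σ = η² = (ζ₇ − ζ₇⁻¹)²`), `E = cmField R = ℚ[T]/(T⁶ + 7T⁴
    + 14T² + 7)`,
by a `3`-adic descent — the sextic twin of part I `Ring2WeilCoverageCMFieldZeta5` (`[3] ≠ [1]` for `ℚ(ζ₅)`): the prime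
`3` is INERT in `F` (`𝔽₂₇`) and INERT in `E/F` (`𝔽₇₂₉`), so the norm form `N(a, b) = a² − σb²`
(`a = a₀ + a₁σ + a₂σ²`, `b = b₀ + b₁σ
    + b₂σ²`; three integer quadratic forms `N₀, N₁, N₂` in six variables on the basis
`1, σ, σ²`, `σ³ = −7σ² − 14σ − 7`) is ANISOTROPIC mod `3` (`3⁶ = 729` cases, `decide`), and `N
    = (3wM², 0, 0)` descends
(`aᵢ, bᵢ ↦ aᵢ/3, bᵢ/3`, `M ↦ M/3`).

* §1 `zeta7_zmod3_anisotropic` (729 cases), `zeta7_int_descent`, `zeta7_rat_no_solution`.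
* §2 `realPolyQ_R7`, `root_rel_R7` (`σ³ + 7σ² + 14σ + 7 = 0`), `exists_coords_R7` (`F = ℚ ⊕ ℚσ ⊕ ℚσ²`),
  `coords_eq_zero_R7`, `sq_sub_root_mul_sq_ne_R7` (`a² − σb² ≠ 3w`).
* §3 **`zeta7_mk_three_mul_ne_splitDiscriminantClassCM`**: `[3w] ≠ [(−1)²]` for `3 ∤ w` — the rows `W12.ℚ(ζ₇).[3]`,
  `[6] (= [3])`, `[15]`, `[21]`, `[33]`, `[39]`, … of the `g
      = 12` table are NON-SPLIT (no `E`-Lagrangian member, Deligne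
  Cor. 4.2); `zeta7_mk_three_ne_splitDiscriminantClassCM`; `zeta7_mul_cmConj_ne_three` (no `z ∈ ℚ(ζ₇)` with `z z̄
      = 3`).

THEOREMS ONLY: no `def`, no named fact, no `sorry`; `HC_CM` does not occur; nothing about the Hodge conjecture is
asserted. The `Fact` instance arguments (irreducibility of `R` and of `R(T²)` over `ℚ`) are supplied by parts X-U/X-V
(`zeta7_fact_cmPolyQ`, `zeta7_fact_realPolyQ`).

## References
* [Deligne1982HodgeCycles] P. Deligne (notes by J. S. Milne), LNM 900 (1982), §4 p. 30 (1), Cor. 4.2.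
* [Washington1997] L. C. Washington, *Introduction to Cyclotomic Fields*, GTM 83, Ch. 2 (`3` is inert in `ℚ(ζ₇)`:
  `3` has order `6` mod `7`).
-/

noncomputable section

set_option linter.dupNamespace false

open Polynomial

namespace Summit.HodgeConjecture.HodgeConjecture.Ring2.WeilCoverageCM

open Literature.AlgebraicGeometry.Deligne1982
open Literature.AlgebraicGeometry.HodgeTheory (splitDiscriminantClassCM)

/-! ### §1 The arithmetic core: anisotropy mod 3 (729 cases) and descent -/

/-- **Anisotropy of `a² − σb²` over `O_E/3 = 𝔽₇₂₉ → O_F/3 = 𝔽₂₇`** in the coordinates `a = a₀ + a₁σ + a₂σ²`,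
`b = b₀ + b₁σ + b₂σ²`, `σ³ = −7σ² − 14σ − 7`: the three coordinate forms vanish mod `3` only at the origin
(`3⁶ = 729` cases, `decide`). [folklore] -/
theorem zeta7_zmod3_anisotropic :
    ∀ a₀ a₁ a₂ b₀ b₁ b₂ : ZMod 3, 245 * b₂ ^ 2 - 98 * b₁ * b₂ + 7 * b₁ ^ 2 + 14 * b₀ * b₂ + 49 * a₂ ^ 2
        - 14 * a₁ * a₂ + a₀ ^ 2 = 0 → 441 * b₂ ^ 2 - 182 * b₁ * b₂ + 14 * b₁ ^ 2 + 28 * b₀ * b₂ - b₀ ^ 2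
        + 91 * a₂ ^ 2 - 28 * a₁ * a₂ + 2 * a₀ * a₁ = 0 → 154 * b₂ ^ 2 - 70 * b₁ * b₂ + 7 * b₁ ^ 2 + 14 * b₀ * b₂
        - 2 * b₀ * b₁ + 35 * a₂ ^ 2 - 14 * a₁ * a₂ + a₁ ^ 2 + 2 * a₀ * a₂ = 0 →
      a₀ = 0 ∧ a₁ = 0 ∧ a₂ = 0 ∧ b₀ = 0 ∧ b₁ = 0 ∧ b₂ = 0 := by
  decide

/-- **Integer descent**: `N₀ = 3wM²`, `N₁ = N₂ = 0` with `3 ∤ w` force `M = 0` (reduce mod `3`, divide all six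
coordinates by `3` — the forms are quadratic —, then `3 ∣ M`, repeat). [folklore] -/
theorem zeta7_int_descent (w : ℤ) (hw : ¬ (3 : ℤ) ∣ w) :
    ∀ (n : ℕ) (A₀ A₁ A₂ B₀ B₁ B₂ M : ℤ), -(n : ℤ) ≤ M → M ≤ n →
      245 * B₂ ^ 2 - 98 * B₁ * B₂ + 7 * B₁ ^ 2 + 14 * B₀ * B₂ + 49 * A₂ ^ 2 - 14 * A₁ * A₂ + A₀ ^ 2
          = 3 * w * M ^ 2 → 441 * B₂ ^ 2 - 182 * B₁ * B₂ + 14 * B₁ ^ 2 + 28 * B₀ * B₂ - B₀ ^ 2 + 91 * A₂ ^ 2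
          - 28 * A₁ * A₂ + 2 * A₀ * A₁ = 0 → 154 * B₂ ^ 2 - 70 * B₁ * B₂ + 7 * B₁ ^ 2 + 14 * B₀ * B₂
          - 2 * B₀ * B₁ + 35 * A₂ ^ 2 - 14 * A₁ * A₂ + A₁ ^ 2 + 2 * A₀ * A₂ = 0 → M = 0 := by
  intro n
  induction n with
  | zero => intro A₀ A₁ A₂ B₀ B₁ B₂ M h1 h2 _ _ _; omega
  | succ n ih =>
    intro A₀ A₁ A₂ B₀ B₁ B₂ M h1 h2 hX hY hZ
    have h3 : (A₀ : ZMod 3) = 0 ∧ (A₁ : ZMod 3) = 0 ∧ (A₂ : ZMod 3) = 0 ∧ (B₀ : ZMod 3) = 0 ∧ (B₁ : ZMod 3) = 0 ∧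
        (B₂ : ZMod 3) = 0 := by
      apply zeta7_zmod3_anisotropic
      · have := congrArg (Int.cast : ℤ → ZMod 3) hX
        push_cast at this
        rw [this, show (3 : ZMod 3) = 0 from rfl]
        ring
      · have := congrArg (Int.cast : ℤ → ZMod 3) hY
        push_cast at this
        exact this
      · have := congrArg (Int.cast : ℤ → ZMod 3) hZ
        push_cast at this
        exact this
    obtain ⟨hA₀, hA₁, hA₂, hB₀, hB₁, hB₂⟩ := h3
    rw [ZMod.intCast_zmod_eq_zero_iff_dvd] at hA₀ hA₁ hA₂ hB₀ hB₁ hB₂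
    obtain ⟨A₀', rfl⟩ := hA₀
    obtain ⟨A₁', rfl⟩ := hA₁
    obtain ⟨A₂', rfl⟩ := hA₂
    obtain ⟨B₀', rfl⟩ := hB₀
    obtain ⟨B₁', rfl⟩ := hB₁
    obtain ⟨B₂', rfl⟩ := hB₂
    have hX' : 3 * (245 * B₂' ^ 2 - 98 * B₁' * B₂' + 7 * B₁' ^ 2 + 14 * B₀' * B₂' + 49 * A₂' ^ 2 - 14 * A₁' * A₂'
        + A₀' ^ 2) = w * M ^ 2 := by
      have h9 : (9 : ℤ) * (245 * B₂' ^ 2 - 98 * B₁' * B₂' + 7 * B₁' ^ 2 + 14 * B₀' * B₂' + 49 * A₂' ^ 2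
          - 14 * A₁' * A₂' + A₀' ^ 2) = 3 * w * M ^ 2 := by
        rw [← hX]; ring
      linarith
    have hM3 : (3 : ℤ) ∣ M := by
      have h3 : (3 : ℤ) ∣ w * M ^ 2 := ⟨_, hX'.symm⟩
      rcases (Int.prime_three.dvd_or_dvd h3) with h | h
      · exact absurd h hw
      · exact Int.prime_three.dvd_of_dvd_pow h
    obtain ⟨M', rfl⟩ := hM3
    have hX'' : 245 * B₂' ^ 2 - 98 * B₁' * B₂' + 7 * B₁' ^ 2 + 14 * B₀' * B₂' + 49 * A₂' ^ 2 - 14 * A₁' * A₂'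
        + A₀' ^ 2 = 3 * w * M' ^ 2 := by
      have : 3 * (245 * B₂' ^ 2 - 98 * B₁' * B₂' + 7 * B₁' ^ 2 + 14 * B₀' * B₂' + 49 * A₂' ^ 2 - 14 * A₁' * A₂'
          + A₀' ^ 2) = 3 * (3 * w * M' ^ 2) := by
        rw [hX']; ring
      exact mul_left_cancel₀ three_ne_zero this
    have hY'' : 441 * B₂' ^ 2 - 182 * B₁' * B₂' + 14 * B₁' ^ 2 + 28 * B₀' * B₂' - B₀' ^ 2 + 91 * A₂' ^ 2
        - 28 * A₁' * A₂' + 2 * A₀' * A₁' = 0 := by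
      have : (9 : ℤ) * (441 * B₂' ^ 2 - 182 * B₁' * B₂' + 14 * B₁' ^ 2 + 28 * B₀' * B₂' - B₀' ^ 2 + 91 * A₂' ^ 2
          - 28 * A₁' * A₂' + 2 * A₀' * A₁') = 0 := by
        rw [← hY]; ring
      exact (mul_eq_zero.1 this).resolve_left (by norm_num)
    have hZ'' : 154 * B₂' ^ 2 - 70 * B₁' * B₂' + 7 * B₁' ^ 2 + 14 * B₀' * B₂' - 2 * B₀' * B₁' + 35 * A₂' ^ 2
        - 14 * A₁' * A₂' + A₁' ^ 2 + 2 * A₀' * A₂' = 0 := by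
      have : (9 : ℤ) * (154 * B₂' ^ 2 - 70 * B₁' * B₂' + 7 * B₁' ^ 2 + 14 * B₀' * B₂' - 2 * B₀' * B₁'
          + 35 * A₂' ^ 2 - 14 * A₁' * A₂' + A₁' ^ 2 + 2 * A₀' * A₂') = 0 := by
        rw [← hZ]; ring
      exact (mul_eq_zero.1 this).resolve_left (by norm_num)
    have hM' : M' = 0 := ih A₀' A₁' A₂' B₀' B₁' B₂' M' (by push_cast at h1 h2 ⊢; omega)
      (by push_cast at h1 h2 ⊢; omega) hX'' hY'' hZ''
    rw [hM', mul_zero]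

/-- **No rational solutions**: `N₀ = 3w`, `N₁ = N₂ = 0` has no solution in `ℚ⁶` when `3 ∤ w` (clear denominators,
`zeta7_int_descent`). [folklore] -/
theorem zeta7_rat_no_solution (w : ℤ) (hw : ¬ (3 : ℤ) ∣ w) (a₀ a₁ a₂ b₀ b₁ b₂ : ℚ)
    (hX : 245 * b₂ ^ 2 - 98 * b₁ * b₂ + 7 * b₁ ^ 2 + 14 * b₀ * b₂ + 49 * a₂ ^ 2 - 14 * a₁ * a₂ + a₀ ^ 2
        = 3 * w) (hY : 441 * b₂ ^ 2 - 182 * b₁ * b₂ + 14 * b₁ ^ 2 + 28 * b₀ * b₂ - b₀ ^ 2 + 91 * a₂ ^ 2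
        - 28 * a₁ * a₂ + 2 * a₀ * a₁ = 0) (hZ : 154 * b₂ ^ 2 - 70 * b₁ * b₂ + 7 * b₁ ^ 2 + 14 * b₀ * b₂
        - 2 * b₀ * b₁ + 35 * a₂ ^ 2 - 14 * a₁ * a₂ + a₁ ^ 2 + 2 * a₀ * a₂ = 0) : False := by
  set m : ℕ := a₀.den * a₁.den * a₂.den * b₀.den * b₁.den * b₂.den with hm
  have hm0 : (m : ℤ) ≠ 0 := by
    have : 0 < m := by
      rw [hm]
      exact Nat.mul_pos (Nat.mul_pos (Nat.mul_pos (Nat.mul_pos (Nat.mul_pos a₀.den_pos a₁.den_pos) a₂.den_pos)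
        b₀.den_pos) b₁.den_pos) b₂.den_pos
    exact_mod_cast this.ne'
  have key : ∀ (q : ℚ) (k : ℕ), ((q.num * k : ℤ) : ℚ) = q * (q.den * k : ℕ) := by
    intro q k
    push_cast
    rw [← mul_assoc, Rat.mul_den_eq_num]
  obtain ⟨A₀, hA₀⟩ : ∃ A : ℤ, (A : ℚ) = a₀ * m :=
    ⟨a₀.num * (a₁.den * a₂.den * b₀.den * b₁.den * b₂.den : ℕ), by rw [key, hm]; push_cast; ring⟩
  obtain ⟨A₁, hA₁⟩ : ∃ A : ℤ, (A : ℚ) = a₁ * m :=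
    ⟨a₁.num * (a₀.den * a₂.den * b₀.den * b₁.den * b₂.den : ℕ), by rw [key, hm]; push_cast; ring⟩
  obtain ⟨A₂, hA₂⟩ : ∃ A : ℤ, (A : ℚ) = a₂ * m :=
    ⟨a₂.num * (a₀.den * a₁.den * b₀.den * b₁.den * b₂.den : ℕ), by rw [key, hm]; push_cast; ring⟩
  obtain ⟨B₀, hB₀⟩ : ∃ A : ℤ, (A : ℚ) = b₀ * m :=
    ⟨b₀.num * (a₀.den * a₁.den * a₂.den * b₁.den * b₂.den : ℕ), by rw [key, hm]; push_cast; ring⟩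
  obtain ⟨B₁, hB₁⟩ : ∃ A : ℤ, (A : ℚ) = b₁ * m :=
    ⟨b₁.num * (a₀.den * a₁.den * a₂.den * b₀.den * b₂.den : ℕ), by rw [key, hm]; push_cast; ring⟩
  obtain ⟨B₂, hB₂⟩ : ∃ A : ℤ, (A : ℚ) = b₂ * m :=
    ⟨b₂.num * (a₀.den * a₁.den * a₂.den * b₀.den * b₁.den : ℕ), by rw [key, hm]; push_cast; ring⟩
  have hXZ : 245 * B₂ ^ 2 - 98 * B₁ * B₂ + 7 * B₁ ^ 2 + 14 * B₀ * B₂ + 49 * A₂ ^ 2 - 14 * A₁ * A₂ + A₀ ^ 2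
      = 3 * w * (m : ℤ) ^ 2 := by
    have h : (245 * (B₂ : ℚ) ^ 2 - 98 * (B₁ : ℚ) * (B₂ : ℚ) + 7 * (B₁ : ℚ) ^ 2 + 14 * (B₀ : ℚ) * (B₂ : ℚ)
        + 49 * (A₂ : ℚ) ^ 2 - 14 * (A₁ : ℚ) * (A₂ : ℚ) + (A₀ : ℚ) ^ 2 : ℚ) = 3 * w * ((m : ℤ) : ℚ) ^ 2 := by
      rw [hA₀, hA₁, hA₂, hB₀, hB₁, hB₂]; push_cast; linear_combination ((m : ℚ)) ^ 2 * hX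
    exact_mod_cast h
  have hYZ : 441 * B₂ ^ 2 - 182 * B₁ * B₂ + 14 * B₁ ^ 2 + 28 * B₀ * B₂ - B₀ ^ 2 + 91 * A₂ ^ 2 - 28 * A₁ * A₂
      + 2 * A₀ * A₁ = 0 := by
    have h : (441 * (B₂ : ℚ) ^ 2 - 182 * (B₁ : ℚ) * (B₂ : ℚ) + 14 * (B₁ : ℚ) ^ 2 + 28 * (B₀ : ℚ) * (B₂ : ℚ)
        - (B₀ : ℚ) ^ 2 + 91 * (A₂ : ℚ) ^ 2 - 28 * (A₁ : ℚ) * (A₂ : ℚ) + 2 * (A₀ : ℚ) * (A₁ : ℚ) : ℚ) = 0 := by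
      rw [hA₀, hA₁, hA₂, hB₀, hB₁, hB₂]; linear_combination ((m : ℚ)) ^ 2 * hY
    exact_mod_cast h
  have hZZ : 154 * B₂ ^ 2 - 70 * B₁ * B₂ + 7 * B₁ ^ 2 + 14 * B₀ * B₂ - 2 * B₀ * B₁ + 35 * A₂ ^ 2 - 14 * A₁ * A₂
      + A₁ ^ 2 + 2 * A₀ * A₂ = 0 := by
    have h : (154 * (B₂ : ℚ) ^ 2 - 70 * (B₁ : ℚ) * (B₂ : ℚ) + 7 * (B₁ : ℚ) ^ 2 + 14 * (B₀ : ℚ) * (B₂ : ℚ)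
        - 2 * (B₀ : ℚ) * (B₁ : ℚ) + 35 * (A₂ : ℚ) ^ 2 - 14 * (A₁ : ℚ) * (A₂ : ℚ) + (A₁ : ℚ) ^ 2
        + 2 * (A₀ : ℚ) * (A₂ : ℚ) : ℚ) = 0 := by
      rw [hA₀, hA₁, hA₂, hB₀, hB₁, hB₂]; linear_combination ((m : ℚ)) ^ 2 * hZ
    exact_mod_cast h
  have := zeta7_int_descent w hw (m : ℤ).natAbs A₀ A₁ A₂ B₀ B₁ B₂ m (by omega) (by omega) hXZ hYZ hZZ
  exact hm0 this

/-! ### §2 Coordinates on `F = ℚ[S]/(S³ + 7S² + 14S + 7) = ℚ ⊕ ℚσ ⊕ ℚσ²` -/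

/-- `realPolyQ R = S³ + 7S² + 14S + 7 ∈ ℚ[S]`. [cite: Deligne1982HodgeCycles, §4 p. 30] -/
theorem realPolyQ_R7 {R : Polynomial ℤ} (hR : R = X ^ 3 + C 7 * X ^ 2 + C 14 * X + C 7) :
    realPolyQ R = X ^ 3 + 7 * X ^ 2 + 14 * X + 7 := by
  subst hR
  simp [realPolyQ]

section Coordinates

variable {R : Polynomial ℤ} [Fact (Irreducible (realPolyQ R))]

/-- `σ³ + 7σ² + 14σ + 7 = 0` in `F`. [cite: Deligne1982HodgeCycles, §4 p. 30] -/
theorem root_rel_R7 (hR : R = X ^ 3 + C 7 * X ^ 2 + C 14 * X + C 7) :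
    AdjoinRoot.root (realPolyQ R) ^ 3 + 7 * AdjoinRoot.root (realPolyQ R) ^ 2 + 14 * AdjoinRoot.root (realPolyQ R) + 7
      = 0 := by
  have h : AdjoinRoot.mk (realPolyQ R) (X ^ 3 + 7 * X ^ 2 + 14 * X + 7) = 0 := by
    rw [← realPolyQ_R7 hR]
    exact AdjoinRoot.mk_self
  simpa [map_add, map_mul, map_pow, map_ofNat] using h

/-- `F = ℚ ⊕ ℚσ ⊕ ℚσ²`: every element of `F` is `ι p + ι q · σ
    + ι r · σ²`. [cite: Deligne1982HodgeCycles, §4 p. 30] -/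
theorem exists_coords_R7 (hR : R = X ^ 3 + C 7 * X ^ 2 + C 14 * X + C 7) (x : realField R) :
    ∃ p q r : ℚ, x = AdjoinRoot.of (realPolyQ R) p + AdjoinRoot.of (realPolyQ R) q * AdjoinRoot.root (realPolyQ R) +
      AdjoinRoot.of (realPolyQ R) r * AdjoinRoot.root (realPolyQ R) ^ 2 := by
  have hmonic : (realPolyQ R).Monic := by rw [realPolyQ_R7 hR]; monicity!
  have hdeg : (realPolyQ R).natDegree = 3 := by rw [realPolyQ_R7 hR]; compute_degree!
  have hne1 : realPolyQ R ≠ 1 := by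
    intro h1
    rw [h1, natDegree_one] at hdeg
    exact absurd hdeg (by norm_num)
  induction x using AdjoinRoot.induction_on with
  | ih P =>
    have hmk : (AdjoinRoot.mk (realPolyQ R) P : realField R) =
        AdjoinRoot.mk (realPolyQ R) (P %ₘ realPolyQ R) := by
      rw [AdjoinRoot.mk_eq_mk]
      refine ⟨P /ₘ realPolyQ R, ?_⟩
      calc P - P %ₘ realPolyQ R
          = (P %ₘ realPolyQ R + realPolyQ R * (P /ₘ realPolyQ R)) - P %ₘ realPolyQ R := by
            rw [Polynomial.modByMonic_add_div P (realPolyQ R)]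
        _ = realPolyQ R * (P /ₘ realPolyQ R) := by ring
    have hrdeg : (P %ₘ realPolyQ R).natDegree < 3 := by
      have := Polynomial.natDegree_modByMonic_lt P hmonic hne1
      rw [hdeg] at this
      exact this
    refine ⟨(P %ₘ realPolyQ R).coeff 0, (P %ₘ realPolyQ R).coeff 1, (P %ₘ realPolyQ R).coeff 2, ?_⟩
    rw [hmk]
    conv_lhs => rw [Polynomial.as_sum_range' (P %ₘ realPolyQ R) 3 hrdeg]
    simp only [Finset.sum_range_succ, Finset.sum_range_zero, zero_add, ← Polynomial.C_mul_X_pow_eq_monomial,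
      map_add, map_mul, map_pow, AdjoinRoot.mk_C, AdjoinRoot.mk_X, pow_zero, mul_one, pow_one]

/-- `{1, σ, σ²}` is `ℚ`-free: `ι p + ι q · σ + ι r · σ² = 0 ⇒ p = q = r
    = 0`. [cite: Deligne1982HodgeCycles, §4 p. 30] -/
theorem coords_eq_zero_R7 (hR : R = X ^ 3 + C 7 * X ^ 2 + C 14 * X + C 7) {p q r : ℚ}
    (h : AdjoinRoot.of (realPolyQ R) p + AdjoinRoot.of (realPolyQ R) q * AdjoinRoot.root (realPolyQ R) +
      AdjoinRoot.of (realPolyQ R) r * AdjoinRoot.root (realPolyQ R) ^ 2 = 0) :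
    p = 0 ∧ q = 0 ∧ r = 0 := by
  have hmonic : (realPolyQ R).Monic := by rw [realPolyQ_R7 hR]; monicity!
  have hdeg : (realPolyQ R).natDegree = 3 := by rw [realPolyQ_R7 hR]; compute_degree!
  have hmk : (AdjoinRoot.mk (realPolyQ R) (C p + C q * X + C r * X ^ 2) : realField R) = 0 := by
    rw [map_add, map_add, map_mul, map_mul, map_pow, AdjoinRoot.mk_C, AdjoinRoot.mk_C, AdjoinRoot.mk_C, AdjoinRoot.mk_X]
    exact h
  rw [AdjoinRoot.mk_eq_zero] at hmk
  by_cases h0 : C p + C q * X + C r * X ^ 2 = 0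
  · have h1 := congrArg (fun f : Polynomial ℚ => f.coeff 0) h0
    have h2 := congrArg (fun f : Polynomial ℚ => f.coeff 1) h0
    have h3 := congrArg (fun f : Polynomial ℚ => f.coeff 2) h0
    simp at h1 h2 h3
    exact ⟨h1, h2, h3⟩
  · exfalso
    refine hmonic.not_dvd_of_natDegree_lt h0 ?_ hmk
    rw [hdeg]
    have : (C p + C q * X + C r * X ^ 2).natDegree ≤ 2 := by compute_degree
    omega

/-- **No `a, b ∈ F` with `a² − σb² = 3w`, `3 ∤ w`**: the norm form of `E/F` does not represent `3w`. [folklore] -/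
theorem sq_sub_root_mul_sq_ne_R7 (hR : R = X ^ 3 + C 7 * X ^ 2 + C 14 * X + C 7) (w : ℤ) (hw : ¬ (3 : ℤ) ∣ w)
    (a b : realField R) :
    a ^ 2 - AdjoinRoot.root (realPolyQ R) * b ^ 2 ≠ AdjoinRoot.of (realPolyQ R) (3 * w) := by
  obtain ⟨a₀, a₁, a₂, rfl⟩ := exists_coords_R7 hR a
  obtain ⟨b₀, b₁, b₂, rfl⟩ := exists_coords_R7 hR b
  have hσ := root_rel_R7 hR
  intro h
  have key : AdjoinRoot.of (realPolyQ R) (245 * b₂ ^ 2 - 98 * b₁ * b₂ + 7 * b₁ ^ 2 + 14 * b₀ * b₂ + 49 * a₂ ^ 2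
      - 14 * a₁ * a₂ + a₀ ^ 2 - 3 * w) +
      AdjoinRoot.of (realPolyQ R) (441 * b₂ ^ 2 - 182 * b₁ * b₂ + 14 * b₁ ^ 2 + 28 * b₀ * b₂ - b₀ ^ 2
          + 91 * a₂ ^ 2 - 28 * a₁ * a₂ + 2 * a₀ * a₁) * AdjoinRoot.root (realPolyQ R) +
      AdjoinRoot.of (realPolyQ R) (154 * b₂ ^ 2 - 70 * b₁ * b₂ + 7 * b₁ ^ 2 + 14 * b₀ * b₂ - 2 * b₀ * b₁
          + 35 * a₂ ^ 2 - 14 * a₁ * a₂ + a₁ ^ 2 + 2 * a₀ * a₂) * AdjoinRoot.root (realPolyQ R) ^ 2 = 0 := by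
    simp only [map_add, map_sub, map_mul, map_pow, map_ofNat] at h ⊢
    linear_combination h - ((-35 * AdjoinRoot.of (realPolyQ R) b₂ ^ 2 + 14
        * AdjoinRoot.of (realPolyQ R) b₁ * AdjoinRoot.of (realPolyQ R) b₂ - AdjoinRoot.of (realPolyQ R) b₁ ^ 2
        - 2 * AdjoinRoot.of (realPolyQ R) b₀ * AdjoinRoot.of (realPolyQ R) b₂ - 7
        * AdjoinRoot.of (realPolyQ R) a₂ ^ 2 + 2 * AdjoinRoot.of (realPolyQ R) a₁
        * AdjoinRoot.of (realPolyQ R) a₂) + (7 * AdjoinRoot.of (realPolyQ R) b₂ ^ 2 - 2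
        * AdjoinRoot.of (realPolyQ R) b₁ * AdjoinRoot.of (realPolyQ R) b₂
        + AdjoinRoot.of (realPolyQ R) a₂ ^ 2) * AdjoinRoot.root (realPolyQ R)
        + (-AdjoinRoot.of (realPolyQ R) b₂ ^ 2) * AdjoinRoot.root (realPolyQ R) ^ 2) * hσ
  obtain ⟨hX, hY, hZ⟩ := coords_eq_zero_R7 hR key
  exact zeta7_rat_no_solution w hw a₀ a₁ a₂ b₀ b₁ b₂ (by linarith) hY hZ

end Coordinates

/-! ### §3 The certificate on Deligne's carrier `ℚ(ζ₇)` -/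

/-- **`[3w] ≠ [(−1)²] = [1]` in `F^×/Nm_{E/F}(E^×)` for `E = ℚ(ζ₇) = ℚ[T]/(T⁶+7T⁴+14T²+7)`, `F = ℚ(ζ₇)⁺ =
ℚ[S]/(S³+7S²+14S+7)`, `3 ∤ w`**: the class of any `q ∈ F^×` with `q = 3w` is not the split class of `E`-rank `4`. For
the census (b03.23, the `g
    = 12` rows `(3,2)`): the Weil-type components `W12.ℚ(ζ₇).[3]`, `[6]`, `[15]`, `[21]`, `[33]`,
`[39]`, … are NON-SPLIT (no `E`-Lagrangian member, Deligne Cor. 4.2). The `Fact` instance arguments are supplied by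
parts X-U/X-V (`zeta7_fact_cmPolyQ rfl`, `zeta7_fact_realPolyQ rfl`). [cite: Deligne1982HodgeCycles, §4 p. 30 (1) and Cor. 4.2] -/
theorem zeta7_mk_three_mul_ne_splitDiscriminantClassCM {R : Polynomial ℤ} (hR : R = X ^ 3 + C 7 * X ^ 2
    + C 14 * X + C 7)
    [Fact (Irreducible (cmPolyQ R))] [Fact (Irreducible (realPolyQ R))] (w : ℤ) (hw : ¬ (3 : ℤ) ∣ w) (q : (realField R)ˣ)
    (hq : (q : realField R) = AdjoinRoot.of (realPolyQ R) (3 * w)) :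
    (QuotientGroup.mk q : cmNormResidueGroup R) ≠ splitDiscriminantClassCM R 2 := by
  intro h
  rw [splitDiscriminantClassCM, neg_one_sq] at h
  obtain ⟨z, -, hz⟩ := exists_eq_ratCast_mul_norm_of_mk_eq (q := q) (u := 1) (c := 1)
    (by rw [Units.val_one, Rat.cast_one]) h
  rw [Rat.cast_one, one_mul] at hz
  obtain ⟨a, b, rfl⟩ := exists_eq_realToCM_add_mul_cmRoot R z
  rw [norm_coords, algebraMap_realField_eq, hq] at hz
  exact sq_sub_root_mul_sq_ne_R7 hR w hw a b ((realToCM R).injective hz).symm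

/-- **`[3] ≠ [1]`**: the class of `3` itself — row `W12.ℚ(ζ₇).{𝔭₇, (3)}` of the `g = 12` census table, least rational
representative `3` — is a non-split component. [cite: Deligne1982HodgeCycles, §4 p. 30 (1) and Cor. 4.2] -/
theorem zeta7_mk_three_ne_splitDiscriminantClassCM {R : Polynomial ℤ} (hR : R = X ^ 3 + C 7 * X ^ 2 + C 14 * X + C 7)
    [Fact (Irreducible (cmPolyQ R))] [Fact (Irreducible (realPolyQ R))] (q : (realField R)ˣ)
    (hq : (q : realField R) = 3) :
    (QuotientGroup.mk q : cmNormResidueGroup R) ≠ splitDiscriminantClassCM R 2 :=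
  zeta7_mk_three_mul_ne_splitDiscriminantClassCM hR 1 (by norm_num) q (by rw [hq]; simp)

/-- **No `z ∈ E = ℚ(ζ₇)` has `z z̄ = 3`** (`3` is not a norm from `ℚ(ζ₇)` to `ℚ(ζ₇)⁺`), in the shape met by
`HasWeilDiscriminantCM` consumers. [cite: Deligne1982HodgeCycles, §4 p. 30] -/
theorem zeta7_mul_cmConj_ne_three {R : Polynomial ℤ} (hR : R = X ^ 3 + C 7 * X ^ 2 + C 14 * X + C 7)
    [Fact (Irreducible (cmPolyQ R))] [Fact (Irreducible (realPolyQ R))] (z : cmField R) : z * cmConj R z ≠ 3 := by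
  obtain ⟨a, b, rfl⟩ := exists_eq_realToCM_add_mul_cmRoot R z
  rw [norm_coords]
  intro h
  have h3 : realToCM R (AdjoinRoot.of (realPolyQ R) (3 * (1 : ℤ))) = 3 := by
    rw [Int.cast_one, mul_one, realToCM_of]
    exact map_ofNat (algebraMap ℚ (cmField R)) 3
  rw [← h3] at h
  exact sq_sub_root_mul_sq_ne_R7 hR 1 (by norm_num) a b ((realToCM R).injective h)

end Summit.HodgeConjecture.HodgeConjecture.Ring2.WeilCoverageCM

end
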